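import Mathlib
import Literature.NumberTheory.LFunctions.Zhang2022.Section15CU1Value
import HarnessLib

/-!
# Zhang (2022), Lemma 15.3 value clause (repaired, u053ᴿ): the Euler product at `s = 1` against
# `φ(D)²D⁻²·∏_{(q,D)=1}(1−q⁻²)²/(1−χ(q)q⁻²)` — kernel-checked (pointwise form)

Topic `Literature/NumberTheory/LFunctions/Zhang2022` (Landau–Siegel audit tree; verdict-neutral).
Y. Zhang, *Discrete mean estimates and the Landau–Siegel zero*, arXiv:2211.02515v1 (2022)
[Zhang2022LandauSiegel] — **an unrefereed manuscript under adjudication; nothing in this file asserts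
or denies its Theorems 1–2.** ZHANG-L discharge lane (WP15), file 10 of the chain towards the leaf
`Typed.Section15C.Lemma153RpI`: the second clause of Lemma 15.3 for the repaired object
(`Typed.Section15C.Step15_u053R`: "`𝒰₁ⱼ(1) = φ(D)²D⁻²∏_{(q,D)=1}(1−q⁻²)²/(1−χ(q)q⁻²) + O(α₁)`",
p. 87, tex L4349; App. A: "in the case `q ≤ D` … `𝔲₁ⱼ(q,1) = (1−q⁻¹)²` if `q∣D` … This completes the
proof", p. 105), assembled from the per-prime bounds: the factors at `q ∣ D` are EXACTLY `(1−q⁻¹)²`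
(product `φ(D)²/D²`), and at `q ∤ D` they differ from `(1−q⁻²)²/(1−χ(q)q⁻²)` by
`O((|b₁|+|b₂|+|bⱼ|) log q/q²)`, summable over all primes.

What is PROVED here (theorems only; no definitions, no facts): `norm_prod_sub_prod_le_exp` and its
`tprod` version (product perturbation), `totient_sq_div_sq_eq_prod` (`φ(D)²/D² = ∏_{q∣D}(1−q⁻¹)²`),
`eulerU1_eq_tprod_main`, and **`norm_tprod_frakU1FactorR_one_sub_le`**:
`‖∏'_q 𝔲ᴿ₁ⱼ(q,1) − φ(D)²D⁻²·eulerU1‖ ≤ exp(G(K))·C(K)·Λ·(|b₁|+|b₂|+|bⱼ|)`, `Λ = Σ_q log q/q²`,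
with `G, C` explicit in `K` (uniform in `D`).

## References

* Y. Zhang, arXiv:2211.02515v1 (2022), §15 Lemma 15.3 p. 87; App. A p. 105.
  [cite: Zhang2022LandauSiegel, §15 Lemma 15.3 p. 87]
-/

noncomputable section

open Complex Real Filter Topology Finset

namespace Literature.NumberTheory.LFunctions.Zhang2022.Lemma153Rp

open Literature.NumberTheory.LFunctions.Zhang2022
open Literature.NumberTheory.LFunctions.Zhang2022.Typed.Section15A
open Literature.NumberTheory.LFunctions.Zhang2022.Typed.Section15B

/-! ## §1. Product perturbation -/

/-- **`‖∏_A a − ∏_A b‖ ≤ exp(Σ_A(‖a−1‖+‖b−1‖))·Σ_A ‖a−b‖`** (finite products; induction).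
(elementary step: comparing two Euler products factor by factor) [cite: Zhang2022LandauSiegel, App. A p. 105] -/
theorem norm_prod_sub_prod_le_exp {ι : Type*} [DecidableEq ι] (A : Finset ι) (a b : ι → ℂ) :
    ‖∏ i ∈ A, a i - ∏ i ∈ A, b i‖ ≤
      Real.exp (∑ i ∈ A, (‖a i - 1‖ + ‖b i - 1‖)) * ∑ i ∈ A, ‖a i - b i‖ := by
  induction A using Finset.induction_on with
  | empty => simp
  | insert i A hi ih =>
    rw [prod_insert hi, prod_insert hi, sum_insert hi, sum_insert hi]
    have hna : ‖a i‖ ≤ Real.exp ‖a i - 1‖ := by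
      calc ‖a i‖ = ‖(a i - 1) + 1‖ := by rw [sub_add_cancel]
        _ ≤ ‖a i - 1‖ + ‖(1 : ℂ)‖ := norm_add_le _ _
        _ = ‖a i - 1‖ + 1 := by rw [norm_one]
        _ ≤ Real.exp ‖a i - 1‖ := Real.add_one_le_exp _
    have hnb : ‖∏ j ∈ A, b j‖ ≤ Real.exp (∑ j ∈ A, (‖a j - 1‖ + ‖b j - 1‖)) := by
      calc ‖∏ j ∈ A, b j‖ = ∏ j ∈ A, ‖b j‖ := norm_prod _ _
        _ ≤ ∏ j ∈ A, Real.exp (‖a j - 1‖ + ‖b j - 1‖) := by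
            refine prod_le_prod (fun j _ => norm_nonneg _) fun j _ => ?_
            calc ‖b j‖ = ‖(b j - 1) + 1‖ := by rw [sub_add_cancel]
              _ ≤ ‖b j - 1‖ + ‖(1 : ℂ)‖ := norm_add_le _ _
              _ = ‖b j - 1‖ + 1 := by rw [norm_one]
              _ ≤ Real.exp ‖b j - 1‖ := Real.add_one_le_exp _
              _ ≤ Real.exp (‖a j - 1‖ + ‖b j - 1‖) :=
                  Real.exp_le_exp.mpr (by linarith [norm_nonneg (a j - 1)])
        _ = Real.exp (∑ j ∈ A, (‖a j - 1‖ + ‖b j - 1‖)) := (Real.exp_sum _ _).symm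
    have e : a i * ∏ j ∈ A, a j - b i * ∏ j ∈ A, b j =
        a i * (∏ j ∈ A, a j - ∏ j ∈ A, b j) + (a i - b i) * ∏ j ∈ A, b j := by ring
    rw [e]
    set SA : ℝ := ∑ j ∈ A, (‖a j - 1‖ + ‖b j - 1‖) with hSA
    set TA : ℝ := ∑ j ∈ A, ‖a j - b j‖ with hTA
    have hTA0 : 0 ≤ TA := sum_nonneg fun j _ => norm_nonneg _
    have hexp1 : Real.exp ‖a i - 1‖ * Real.exp SA ≤ Real.exp (‖a i - 1‖ + ‖b i - 1‖ + SA) := by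
      rw [← Real.exp_add]; exact Real.exp_le_exp.mpr (by linarith [norm_nonneg (b i - 1)])
    have hexp2 : Real.exp SA ≤ Real.exp (‖a i - 1‖ + ‖b i - 1‖ + SA) :=
      Real.exp_le_exp.mpr (by linarith [norm_nonneg (a i - 1), norm_nonneg (b i - 1)])
    calc ‖a i * (∏ j ∈ A, a j - ∏ j ∈ A, b j) + (a i - b i) * ∏ j ∈ A, b j‖
        ≤ ‖a i‖ * ‖∏ j ∈ A, a j - ∏ j ∈ A, b j‖ + ‖a i - b i‖ * ‖∏ j ∈ A, b j‖ := by
          refine (norm_add_le _ _).trans (le_of_eq ?_); rw [norm_mul, norm_mul]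
      _ ≤ Real.exp ‖a i - 1‖ * (Real.exp SA * TA) + ‖a i - b i‖ * Real.exp SA :=
          add_le_add (mul_le_mul hna ih (norm_nonneg _) (by positivity))
            (mul_le_mul_of_nonneg_left hnb (norm_nonneg _))
      _ = (Real.exp ‖a i - 1‖ * Real.exp SA) * TA + Real.exp SA * ‖a i - b i‖ := by ring
      _ ≤ Real.exp (‖a i - 1‖ + ‖b i - 1‖ + SA) * TA +
          Real.exp (‖a i - 1‖ + ‖b i - 1‖ + SA) * ‖a i - b i‖ :=
          add_le_add (mul_le_mul_of_nonneg_right hexp1 hTA0)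
            (mul_le_mul_of_nonneg_right hexp2 (norm_nonneg _))
      _ = Real.exp (‖a i - 1‖ + ‖b i - 1‖ + SA) * (‖a i - b i‖ + TA) := by ring

/-- **The same for unconditional products**: if `Σ‖a−1‖`, `Σ‖b−1‖`, `Σ‖a−b‖` converge then
`‖∏'a − ∏'b‖ ≤ exp(Σ'‖a−1‖ + Σ'‖b−1‖)·Σ'‖a−b‖`. [cite: Zhang2022LandauSiegel, App. A p. 105] -/
theorem norm_tprod_sub_tprod_le_exp {ι : Type*} {a b : ι → ℂ} (ha : Summable fun i => ‖a i - 1‖)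
    (hb : Summable fun i => ‖b i - 1‖) (hab : Summable fun i => ‖a i - b i‖) :
    ‖∏' i, a i - ∏' i, b i‖ ≤
      Real.exp (∑' i, ‖a i - 1‖ + ∑' i, ‖b i - 1‖) * ∑' i, ‖a i - b i‖ := by
  classical
  have hma : Multipliable a := by
    have h := multipliable_one_add_of_summable ha; simpa only [add_sub_cancel] using h
  have hmb : Multipliable b := by
    have h := multipliable_one_add_of_summable hb; simpa only [add_sub_cancel] using h
  have hTa : Tendsto (fun A : Finset ι => ∏ i ∈ A, a i) atTop (𝓝 (∏' i, a i)) := hma.hasProd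
  have hTb : Tendsto (fun A : Finset ι => ∏ i ∈ A, b i) atTop (𝓝 (∏' i, b i)) := hmb.hasProd
  have hT := hTa.sub hTb
  set R : ℝ := Real.exp (∑' i, ‖a i - 1‖ + ∑' i, ‖b i - 1‖) * ∑' i, ‖a i - b i‖ with hR
  have hbound : ∀ A : Finset ι, ‖∏ i ∈ A, a i - ∏ i ∈ A, b i‖ ≤ R := by
    intro A
    refine (norm_prod_sub_prod_le_exp A a b).trans ?_
    have h1 : ∑ i ∈ A, (‖a i - 1‖ + ‖b i - 1‖) ≤ ∑' i, ‖a i - 1‖ + ∑' i, ‖b i - 1‖ := by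
      rw [sum_add_distrib]
      exact add_le_add (ha.sum_le_tsum A fun i _ => norm_nonneg _)
        (hb.sum_le_tsum A fun i _ => norm_nonneg _)
    have h2 : ∑ i ∈ A, ‖a i - b i‖ ≤ ∑' i, ‖a i - b i‖ := hab.sum_le_tsum A fun i _ => norm_nonneg _
    exact mul_le_mul (Real.exp_le_exp.mpr h1) h2 (sum_nonneg fun i _ => norm_nonneg _) (by positivity)
  have hclosed : IsClosed {z : ℂ | ‖z‖ ≤ R} := isClosed_le continuous_norm continuous_const
  exact hclosed.mem_of_tendsto hT (Filter.Eventually.of_forall hbound)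

/-! ## §2. `φ(D)²/D²` and `eulerU1` as products -/

variable (c' : ℝ) {D : ℕ} (χ : DirichletCharacter ℂ D)

/-- `φ(D)/D = ∏_{q∣D}(1 − q⁻¹)` in `ℂ` (Euler's product formula, Mathlib
`Nat.totient_eq_mul_prod_factors`). [cite: Zhang2022LandauSiegel, §15 Lemma 15.3 p. 87] -/
theorem totient_div_eq_prod [NeZero D] :
    (Nat.totient D : ℂ) / (D : ℂ) = ∏ p ∈ D.primeFactors, (1 - (p : ℂ)⁻¹) := by
  have hD : (D : ℂ) ≠ 0 := by exact_mod_cast NeZero.ne D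
  have h := Nat.totient_eq_mul_prod_factors D
  have h' : (Nat.totient D : ℂ) = (D : ℂ) * ∏ p ∈ D.primeFactors, (1 - (p : ℂ)⁻¹) := by
    have := congrArg (fun r : ℚ => (r : ℂ)) h
    push_cast at this
    exact this
  rw [h', mul_div_cancel_left₀ _ hD]

/-- The factor of `eulerU1` at a prime in the variable `u = q⁻¹`.
[cite: Zhang2022LandauSiegel, §15 Lemma 15.3 p. 87] -/
theorem eulerU1_factor_eq (q : ℕ) :
    (if Nat.Coprime q D then (1 - 1 / ((q : ℕ) : ℂ) ^ 2) ^ 2 / (1 - χ (q : ZMod D) / (q : ℂ) ^ 2)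
      else (1 : ℂ)) =
      if Nat.Coprime q D then (1 - ((q : ℂ)⁻¹) ^ 2) ^ 2 / (1 - χ (q : ZMod D) * ((q : ℂ)⁻¹) ^ 2)
      else 1 := by
  by_cases h : Nat.Coprime q D
  · rw [if_pos h, if_pos h, one_div, inv_pow, div_eq_mul_inv (χ _)]
  · rw [if_neg h, if_neg h]

/-! ## §3. The value bound for the product -/

/-- `‖(1−u²)²/(1−vu²) − 1‖ ≤ 6‖u‖²` for `‖u‖ ≤ 1/2`, `‖v‖ ≤ 1`. [folklore] -/
private theorem norm_main_sub_one_le {u v : ℂ} (hu : ‖u‖ ≤ 1 / 2) (hv : ‖v‖ ≤ 1) :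
    ‖(1 - u ^ 2) ^ 2 / (1 - v * u ^ 2) - 1‖ ≤ 6 * ‖u‖ ^ 2 := by
  have hu2 : ‖u ^ 2‖ ≤ 1 / 4 := by rw [norm_pow]; nlinarith [norm_nonneg u]
  have hden : 3 / 4 ≤ ‖1 - v * u ^ 2‖ := by
    have h1 : ‖v * u ^ 2‖ ≤ 1 / 4 := by
      rw [norm_mul]; calc ‖v‖ * ‖u ^ 2‖ ≤ 1 * (1 / 4) := by gcongr
        _ = 1 / 4 := one_mul _
    have := norm_sub_norm_le (1 : ℂ) (v * u ^ 2); rw [norm_one] at this; linarith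
  have hne : (1 : ℂ) - v * u ^ 2 ≠ 0 := by
    intro h; rw [h, norm_zero] at hden; linarith
  have e : (1 - u ^ 2) ^ 2 / (1 - v * u ^ 2) - 1 = u ^ 2 * (u ^ 2 - 2 + v) / (1 - v * u ^ 2) := by
    rw [div_sub_one hne]; congr 1; ring
  rw [e, norm_div, norm_mul, div_le_iff₀ (by linarith)]
  have hnum : ‖u ^ 2 - 2 + v‖ ≤ 4 := by
    calc ‖u ^ 2 - 2 + v‖ ≤ ‖u ^ 2 - 2‖ + ‖v‖ := norm_add_le _ _
      _ ≤ ‖u ^ 2‖ + ‖(2 : ℂ)‖ + ‖v‖ := by gcongr; exact norm_sub_le _ _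
      _ ≤ 1 / 4 + 2 + 1 := by
          have : ‖(2 : ℂ)‖ = 2 := by simp
          rw [this]; gcongr
      _ ≤ 4 := by norm_num
  rw [norm_pow] at hu2 ⊢
  calc ‖u‖ ^ 2 * ‖u ^ 2 - 2 + v‖ ≤ ‖u‖ ^ 2 * 4 := by gcongr
    _ ≤ 6 * ‖u‖ ^ 2 * ‖1 - v * u ^ 2‖ := by nlinarith [sq_nonneg ‖u‖]

/-- `Σ_q log q/q²` converges (`log q ≤ 2√q`). [folklore] -/
private theorem summable_log_div_sq :
    Summable fun q : Nat.Primes => Real.log (q : ℕ) / ((q : ℕ) : ℝ) ^ 2 := by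
  have h : Summable fun n : ℕ => 2 * (n : ℝ) ^ (-(3 / 2 : ℝ)) :=
    (Real.summable_nat_rpow.mpr (by norm_num)).mul_left 2
  refine Summable.of_nonneg_of_le (fun q => by positivity) (fun q => ?_)
    (h.comp_injective Subtype.val_injective)
  have hq0 : (0 : ℝ) < (q : ℕ) := by exact_mod_cast q.prop.pos
  have hlog := Real.log_le_rpow_div hq0.le (show (0 : ℝ) < 1 / 2 by norm_num)
  simp only [Function.comp]
  rw [div_le_iff₀ (by positivity)]
  calc Real.log (q : ℕ) ≤ ((q : ℕ) : ℝ) ^ (1 / 2 : ℝ) / (1 / 2) := hlog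
    _ = 2 * ((q : ℕ) : ℝ) ^ (1 / 2 : ℝ) := by ring
    _ = 2 * ((q : ℕ) : ℝ) ^ (-(3 / 2 : ℝ)) * ((q : ℕ) : ℝ) ^ 2 := by
        rw [show ((q : ℕ) : ℝ) ^ 2 = ((q : ℕ) : ℝ) ^ (2 : ℝ) by norm_cast, mul_assoc,
          ← Real.rpow_add hq0]
        norm_num

/-- **The value clause, pointwise form**: for fixed `(D, χ, j)` with `χ` quadratic, the Euler
product of `𝓜₁(1,1;1−βⱼ)` convergent to a non-zero value, `ϖ₁ⱼ(1) = 1`, `βⱼ = b·i` and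
`‖F_q(1,1;1−βⱼ)‖⁻¹ ≤ 2K` for all primes `q`:
`‖∏'_q 𝔲ᴿ₁ⱼ(q,1) − φ(D)²D⁻²·∏_{(q,D)=1}(1−q⁻²)²/(1−χ(q)q⁻²)‖ ≤ exp(G(K))·C(K)·Λ·(|b₁|+|b₂|+|b|)`
with `Λ = Σ_q log q/q²` and `G, C` the explicit absolute expressions in `K` of the statement (the
factors at `q ∣ D` are exactly `(1−q⁻¹)²`, with product `φ(D)²/D²`; the others are compared by
`norm_frakU1FactorR_one_sub_main_le`). [cite: Zhang2022LandauSiegel, §15 Lemma 15.3 p. 87] -/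
theorem norm_tprod_frakU1FactorR_one_sub_le [NeZero D] (hquad : χ.IsQuadratic) (j : ℕ) {b : ℝ}
    (hb : Skeleton.betaJ c' D j = (b : ℂ) * I)
    (hmul : Multipliable fun p : Nat.Primes =>
      calM1Factor c' χ (p : ℕ) 1 1 (1 - Skeleton.betaJ c' D j))
    (hne : calM1 c' χ 1 1 (1 - Skeleton.betaJ c' D j) ≠ 0) (h1 : varpi1 c' χ j 1 = 1) {K : ℝ}
    (hK : ∀ q : ℕ, q.Prime → ‖calM1Factor c' χ q 1 1 (1 - Skeleton.betaJ c' D j)‖⁻¹ ≤ 2 * K) :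
    ‖(∏' q : Nat.Primes, Typed.AppendixA2.frakU1FactorR c' χ j (q : ℕ) 1) -
        (Nat.totient D : ℂ) ^ 2 / (D : ℂ) ^ 2 * Typed.Section15C.eulerU1 χ‖ ≤
      Real.exp (∑' q : Nat.Primes, ((((q : ℕ) : ℝ)⁻¹) ^ 2 +
          2 * K * (90 * (∑' m : ℕ, ((m : ℝ) + 1) ^ 2 * (1 / 2 : ℝ) ^ m) + 72 +
              45 * (∑' m : ℕ, ((m : ℝ) + 2) ^ 2 * (1 / 2 : ℝ) ^ m) ^ 2) / (q : ℕ) *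
            (24 * ((q : ℕ) : ℝ)⁻¹ + 8 * (((q : ℕ) : ℝ)⁻¹) ^ 2) + 6 * (((q : ℕ) : ℝ)⁻¹) ^ 2)) *
        ((14 + 54 * K * (8 * (∑' m : ℕ, ((m : ℝ) + 1) ^ 2 * (1 / 2 : ℝ) ^ m) +
            9 * (∑' m : ℕ, ((m : ℝ) + 2) ^ 2 * (1 / 2 : ℝ) ^ m) ^ 2 +
            13 * (4 * ((16 / 3) * (∑' k : ℕ, ((k : ℝ) + 1) ^ 2 * (1 / 2 : ℝ) ^ k) *
              (∑' k : ℕ, ((k : ℝ) + 1) ^ 3 * (3 / 4 : ℝ) ^ k)) + 87) + 48)) *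
          (∑' q : Nat.Primes, Real.log (q : ℕ) / ((q : ℕ) : ℝ) ^ 2) *
          (|Skeleton.b1 c' D| + |Skeleton.b2 c' D| + |b|)) := by
  classical
  set s₀ : ℂ := 1 - Skeleton.betaJ c' D j with hs₀
  set Z₂ : ℝ := ∑' m : ℕ, ((m : ℝ) + 1) ^ 2 * (1 / 2 : ℝ) ^ m with hZ₂
  set W : ℝ := ∑' m : ℕ, ((m : ℝ) + 2) ^ 2 * (1 / 2 : ℝ) ^ m with hW
  set Z₃ : ℝ := ∑' k : ℕ, ((k : ℝ) + 1) ^ 3 * (3 / 4 : ℝ) ^ k with hZ₃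
  set M : ℝ := 2 * K * (90 * Z₂ + 72 + 45 * W ^ 2) with hM
  set CV : ℝ := 14 + 54 * K * (8 * Z₂ + 9 * W ^ 2 + 13 * (4 * ((16 / 3) * Z₂ * Z₃) + 87) + 48) with hCV
  set β : ℝ := |Skeleton.b1 c' D| + |Skeleton.b2 c' D| + |b| with hβ
  set Λ : ℝ := ∑' q : Nat.Primes, Real.log (q : ℕ) / ((q : ℕ) : ℝ) ^ 2 with hΛ
  have hZ₂0 : 0 ≤ Z₂ := tsum_nonneg fun m => by positivity
  have hW0 : 0 ≤ W := tsum_nonneg fun m => by positivity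
  have hZ₃0 : 0 ≤ Z₃ := tsum_nonneg fun m => by positivity
  have hK0 : 0 ≤ K := by
    have h := hK 2 Nat.prime_two
    have h0 : 0 ≤ ‖calM1Factor c' χ 2 1 1 s₀‖⁻¹ := inv_nonneg.mpr (norm_nonneg _)
    linarith
  have hM0 : 0 ≤ M := by rw [hM]; positivity
  have hCV0 : 0 ≤ CV := by rw [hCV]; positivity
  have hβ0 : 0 ≤ β := by rw [hβ]; positivity
  have hΛ0 : 0 ≤ Λ := tsum_nonneg fun q => by positivity
  -- the three families
  set a : Nat.Primes → ℂ := fun q => Typed.AppendixA2.frakU1FactorR c' χ j (q : ℕ) 1 with ha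
  set a' : Nat.Primes → ℂ := fun q => if (q : ℕ) ∣ D then 1 else a q with ha'
  set b' : Nat.Primes → ℂ := fun q => if (q : ℕ) ∣ D then 1 else
    (1 - (((q : ℕ) : ℂ)⁻¹) ^ 2) ^ 2 / (1 - χ ((q : ℕ) : ZMod D) * (((q : ℕ) : ℂ)⁻¹) ^ 2) with hb'
  set f : Nat.Primes → ℂ := fun q => if (q : ℕ) ∣ D then (1 - ((q : ℕ) : ℂ)⁻¹) ^ 2 else 1 with hf
  -- characters at primes
  have hchi0 : ∀ q : Nat.Primes, (q : ℕ) ∣ D → χ ((q : ℕ) : ZMod D) = 0 := by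
    intro q hq
    apply χ.map_nonunit
    rw [ZMod.isUnit_iff_coprime]
    exact fun h => (Nat.Prime.coprime_iff_not_dvd q.prop).mp h hq
  have hchi1 : ∀ q : Nat.Primes, ¬ (q : ℕ) ∣ D →
      χ ((q : ℕ) : ZMod D) = 1 ∨ χ ((q : ℕ) : ZMod D) = -1 := by
    intro q hq
    exact AppendixALocal.chi_val_eq_one_or_neg_one χ hquad
      ((Nat.Prime.coprime_iff_not_dvd q.prop).mpr hq)
  -- `a = f · a'`
  have haeq : ∀ q, a q = f q * a' q := by
    intro q
    by_cases hq : (q : ℕ) ∣ D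
    · simp only [ha, ha', hf, if_pos hq, mul_one]
      rw [frakU1FactorR_eq_of_chi_eq_zero c' χ (hchi0 q hq) j h1 1, Complex.cpow_neg_one]
    · simp only [ha', hf, if_neg hq, one_mul]
  -- the finite support of `f`
  set emb : {q // q ∈ D.primeFactors} → Nat.Primes :=
    fun q => ⟨q.1, Nat.prime_of_mem_primeFactors q.2⟩ with hemb
  have hemb_inj : Function.Injective emb := by
    intro x y h; exact Subtype.ext (by simpa [hemb] using congrArg Subtype.val h)
  set S : Finset Nat.Primes := D.primeFactors.attach.image emb with hS
  have hmemS : ∀ p : Nat.Primes, p ∈ S ↔ (p : ℕ) ∣ D := by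
    intro p; constructor
    · intro hp; obtain ⟨q, -, hq⟩ := Finset.mem_image.mp hp; rw [← hq]
      exact Nat.dvd_of_mem_primeFactors q.2
    · intro hp
      exact Finset.mem_image.mpr ⟨⟨p, Nat.mem_primeFactors.mpr ⟨p.prop, hp, NeZero.ne D⟩⟩,
        Finset.mem_attach _ _, Subtype.ext rfl⟩
  have hfS : ∀ q ∉ S, f q = 1 := fun q hq => by simp only [hf, if_neg (fun h => hq ((hmemS q).mpr h))]
  have hfP : HasProd f (∏ q ∈ S, f q) := hasProd_prod_of_ne_finset_one hfS
  set PD : ℂ := ∏ q ∈ S, f q with hPD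
  -- `P_D = φ(D)²/D²`
  have hPDeq : (Nat.totient D : ℂ) ^ 2 / (D : ℂ) ^ 2 = PD := by
    rw [← div_pow, totient_div_eq_prod, ← prod_pow, hPD, ← Finset.prod_attach D.primeFactors, hS,
      Finset.prod_image fun x _ y _ h => hemb_inj h]
    refine Finset.prod_congr rfl fun q _ => ?_
    simp only [hf, hemb, if_pos (Nat.dvd_of_mem_primeFactors q.2)]
  have hPDn : ‖PD‖ ≤ 1 := by
    rw [hPD, norm_prod]
    calc ∏ q ∈ S, ‖f q‖ ≤ ∏ q ∈ S, (1 : ℝ) := by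
          refine prod_le_prod (fun q _ => norm_nonneg _) fun q hq => ?_
          have hqD := (hmemS q).mp hq
          simp only [hf, if_pos hqD, norm_pow]
          have hq2 : (2 : ℝ) ≤ (q : ℕ) := by exact_mod_cast q.prop.two_le
          have hreal : (1 : ℂ) - ((q : ℕ) : ℂ)⁻¹ = ((1 - ((q : ℕ) : ℝ)⁻¹ : ℝ) : ℂ) := by push_cast; ring
          have hle1 : ‖(1 : ℂ) - ((q : ℕ) : ℂ)⁻¹‖ ≤ 1 := by
            rw [hreal, Complex.norm_real, Real.norm_eq_abs, abs_le]
            have : 0 < ((q : ℕ) : ℝ)⁻¹ := by positivity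
            have : ((q : ℕ) : ℝ)⁻¹ ≤ 1 / 2 := by rw [← one_div]; exact one_div_le_one_div_of_le (by norm_num) hq2
            constructor <;> linarith
          calc ‖(1 : ℂ) - ((q : ℕ) : ℂ)⁻¹‖ ^ 2 ≤ 1 ^ 2 := pow_le_pow_left₀ (norm_nonneg _) hle1 2
            _ = 1 := one_pow 2
      _ = 1 := prod_const_one
  -- `eulerU1 = ∏' b'`
  have hEuler : Typed.Section15C.eulerU1 χ = ∏' q, b' q := by
    unfold Typed.Section15C.eulerU1
    refine tprod_congr fun q => ?_
    rw [eulerU1_factor_eq χ (q : ℕ)]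
    by_cases hq : (q : ℕ) ∣ D
    · have hnc : ¬ Nat.Coprime (q : ℕ) D := fun h => (Nat.Prime.coprime_iff_not_dvd q.prop).mp h hq
      simp only [hb', if_pos hq, if_neg hnc]
    · have hc : Nat.Coprime (q : ℕ) D := (Nat.Prime.coprime_iff_not_dvd q.prop).mpr hq
      simp only [hb', if_neg hq, if_pos hc]
  -- summable majorants over the primes
  have hinv2 : Summable fun q : Nat.Primes => (((q : ℕ) : ℝ)⁻¹) ^ 2 := by
    have h : Summable fun q : Nat.Primes => (((q : ℕ) : ℝ) ^ 2)⁻¹ :=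
      (Real.summable_nat_pow_inv.mpr one_lt_two).comp_injective
        (i := (Subtype.val : Nat.Primes → ℕ)) Subtype.val_injective
    refine h.congr fun q => ?_
    simp [inv_pow]
  have hinv3 : Summable fun q : Nat.Primes => (((q : ℕ) : ℝ)⁻¹) ^ 3 := by
    have h : Summable fun q : Nat.Primes => (((q : ℕ) : ℝ) ^ 3)⁻¹ :=
      (Real.summable_nat_pow_inv.mpr (by norm_num : 1 < 3)).comp_injective
        (i := (Subtype.val : Nat.Primes → ℕ)) Subtype.val_injective
    refine h.congr fun q => ?_
    simp [inv_pow]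
  set g₁ : Nat.Primes → ℝ := fun q => (((q : ℕ) : ℝ)⁻¹) ^ 2 +
    M / (q : ℕ) * (24 * ((q : ℕ) : ℝ)⁻¹ + 8 * (((q : ℕ) : ℝ)⁻¹) ^ 2) with hg₁
  have hg₁sum : Summable g₁ := by
    refine ((hinv2.add ((hinv2.mul_left (24 * M)).add (hinv3.mul_left (8 * M)))).congr fun q => ?_)
    simp only [hg₁, div_eq_mul_inv]; ring
  have hg₂sum : Summable fun q : Nat.Primes => 6 * (((q : ℕ) : ℝ)⁻¹) ^ 2 := hinv2.mul_left 6
  have hΛsum : Summable fun q : Nat.Primes => CV * β * (Real.log (q : ℕ) / ((q : ℕ) : ℝ) ^ 2) :=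
    summable_log_div_sq.mul_left _
  -- per-prime bounds
  have hnu : ∀ q : Nat.Primes, ‖((q : ℕ) : ℂ)⁻¹‖ = ((q : ℕ) : ℝ)⁻¹ := fun q => by
    rw [norm_inv, Complex.norm_natCast]
  have ha'1 : ∀ q, ‖a' q - 1‖ ≤ g₁ q := by
    intro q
    have hq0 : (0 : ℝ) < (q : ℕ) := by exact_mod_cast q.prop.pos
    by_cases hq : (q : ℕ) ∣ D
    · simp only [ha', if_pos hq, sub_self, norm_zero, hg₁]; positivity
    · simp only [ha', if_neg hq, ha]
      have hv2 : χ ((q : ℕ) : ZMod D) ^ 2 = 1 := by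
        rcases hchi1 q hq with h | h <;> rw [h] <;> norm_num
      have h := norm_frakU1FactorR_sub_one_le c' χ q.prop hv2 j hmul hne (hK q q.prop)
        (s := 1) (by norm_num)
      rw [Complex.cpow_neg_one, hnu q] at h
      simpa [hg₁, hM, hZ₂, hW] using h
  have hb'1 : ∀ q, ‖b' q - 1‖ ≤ 6 * (((q : ℕ) : ℝ)⁻¹) ^ 2 := by
    intro q
    by_cases hq : (q : ℕ) ∣ D
    · simp only [hb', if_pos hq, sub_self, norm_zero]; positivity
    · simp only [hb', if_neg hq]
      have hu : ‖((q : ℕ) : ℂ)⁻¹‖ ≤ 1 / 2 := AppendixALocal.norm_inv_natCast_le_half q.prop.two_le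
      have h := norm_main_sub_one_le hu (χ.norm_le_one ((q : ℕ) : ZMod D))
      rwa [hnu q] at h
  have hab : ∀ q, ‖a' q - b' q‖ ≤ CV * β * (Real.log (q : ℕ) / ((q : ℕ) : ℝ) ^ 2) := by
    intro q
    by_cases hq : (q : ℕ) ∣ D
    · simp only [ha', hb', if_pos hq, sub_self, norm_zero]; positivity
    · simp only [ha', hb', if_neg hq, ha]
      have h := norm_frakU1FactorR_one_sub_main_le c' χ q.prop (hchi1 q hq) j hb hmul hne (hK q q.prop)
      refine h.trans (le_of_eq ?_)
      simp only [hCV, hβ, hZ₂, hW, hZ₃]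
      rw [inv_pow, div_eq_mul_inv]
      ring
  have hsa : Summable fun q => ‖a' q - 1‖ :=
    Summable.of_nonneg_of_le (fun _ => norm_nonneg _) ha'1 hg₁sum
  have hsb : Summable fun q => ‖b' q - 1‖ :=
    Summable.of_nonneg_of_le (fun _ => norm_nonneg _) hb'1 hg₂sum
  have hsab : Summable fun q => ‖a' q - b' q‖ :=
    Summable.of_nonneg_of_le (fun _ => norm_nonneg _) hab hΛsum
  -- the products
  have hma' : Multipliable a' := by
    have h := multipliable_one_add_of_summable hsa; simpa only [add_sub_cancel] using h
  have hprodA : ∏' q, a q = PD * ∏' q, a' q := by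
    have h := hfP.mul hma'.hasProd
    have hfun : (fun q => f q * a' q) = a := funext fun q => (haeq q).symm
    rw [hfun] at h
    exact h.tprod_eq
  -- assemble
  have hdiff := norm_tprod_sub_tprod_le_exp hsa hsb hsab
  rw [hprodA, hPDeq, hEuler, ← mul_sub, norm_mul]
  have hexp : Real.exp (∑' q, ‖a' q - 1‖ + ∑' q, ‖b' q - 1‖) ≤
      Real.exp (∑' q : Nat.Primes, (g₁ q + 6 * (((q : ℕ) : ℝ)⁻¹) ^ 2)) := by
    apply Real.exp_le_exp.mpr
    rw [hg₁sum.tsum_add hg₂sum]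
    exact add_le_add (hsa.tsum_le_tsum ha'1 hg₁sum) (hsb.tsum_le_tsum hb'1 hg₂sum)
  have hT : ∑' q, ‖a' q - b' q‖ ≤ CV * β * Λ := by
    calc ∑' q, ‖a' q - b' q‖ ≤ ∑' q : Nat.Primes, CV * β * (Real.log (q : ℕ) / ((q : ℕ) : ℝ) ^ 2) :=
          hsab.tsum_le_tsum hab hΛsum
      _ = CV * β * Λ := by rw [tsum_mul_left]
  have hT0 : 0 ≤ ∑' q, ‖a' q - b' q‖ := tsum_nonneg fun q => norm_nonneg _
  calc ‖PD‖ * ‖∏' q, a' q - ∏' q, b' q‖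
      ≤ 1 * (Real.exp (∑' q : Nat.Primes, (g₁ q + 6 * (((q : ℕ) : ℝ)⁻¹) ^ 2)) * (CV * β * Λ)) := by
        refine mul_le_mul hPDn (hdiff.trans ?_) (norm_nonneg _) zero_le_one
        exact mul_le_mul hexp hT hT0 (by positivity)
    _ = _ := by simp only [hg₁, hM, hCV, hβ, hΛ, hZ₂, hW, hZ₃]; ring

end Literature.NumberTheory.LFunctions.Zhang2022.Lemma153Rp

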